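import Summits.ResolutionOfSingularities.ResolutionOfSingularities.Theorems.EquisingularLiftEquisingularLiftCentreBlowupFlatExceptional
import Literature.AlgebraicGeometry.Resolution.BlowupsRelativeCartier
import Literature.AlgebraicGeometry.Resolution.BlowupsIntegral
import Literature.AlgebraicGeometry.Resolution.ZariskiSections
import Mathlib.AlgebraicGeometry.IdealSheaf.Functorial
import HarnessLib

/-!
# `EquisingularLift`, line `Sketch` (strata-split v7) — next layer H3: blowing up a centre with flat exceptional
# divisor keeps the special fibre integral (hence irreducible)

Crux `stmt-ResolutionOfSingularities-15660` = `Theses.EquisingularLift.EquisingularLift`; helper H3 of the chain plan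
`L/w45b/CHAIN.md` §5 (`isIrreducible_specialFibre_blowup`), generalising the section case
`isIrreducible_specialFibre_of_isBlowup_section` (p170771, centre `C = s(Spec O)`) to an ARBITRARY centre whose
exceptional divisor is flat over the base (H1 = `flat_exceptional_of_isBlowup_regularCentre`, p460210, gives this for
regular `O`-flat centres of a regular ambient). [OURS · L1 W4.5b] NOT a statement of any manuscript.

Setting: `O` a local ring with residue field `κ` and closed point `s₀` (`σ : Spec κ → Spec O`), `r : X → Spec O`,
`K` an ideal sheaf on `X` (the centre `C = V(K)`), `τ : X' → X` a blow-up of `X` along `K` (universal property,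
`IsBlowup`) whose exceptional divisor `V(K · 𝒪_{X'}) → Spec O` is flat. Write `X_κ = X ×_{Spec O} Spec κ` for the
scheme-theoretic special fibre (Mathlib's chosen fibre product).

* `range_specMap_residue`, `range_fst_specialFibre` — `σ(Spec κ) = {s₀}` and `|X_κ| ↠ r⁻¹(s₀)`;
* `isIrreducible_preimage_closedPoint` — if `X_κ` is an irreducible scheme then the set `r⁻¹(s₀)` is irreducible;
* `comap_fst_specialFibre_ne_bot` — if some point of `r⁻¹(s₀)` lies off the support of `K` then `K · 𝒪_{X_κ} ≠ 0`;
* `isIntegral_specialFibre_of_isBlowup_of_flat_exceptional` (**H3**) — if `X_κ` is integral and some point of the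
  special fibre lies off the centre, then `X'_κ = X' ×_{Spec O} Spec κ` is integral and the special fibre
  `(τ ≫ r)⁻¹(s₀)` of `X'` is irreducible;
* `isIntegral_specialFibre_of_isBlowup_regularCentre` — H1 + H3: the same conclusion for a blow-up of a regular
  locally Noetherian `U/O` along a regular centre flat over `O` (`flat_exceptional_of_isBlowup_regularCentre`,
  p460210, supplies the flat exceptional divisor).

Proof of H3: by flatness of the exceptional divisor the base change `X' ×_X X_κ → X_κ` is a blow-up of `X_κ` along
`K · 𝒪_{X_κ}` (`IsBlowup.pullback_snd_of_flat_exceptional`, Stacks 056P (1) + 0805), a non-zero ideal sheaf of the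
integral scheme `X_κ`, so `X' ×_X X_κ` is integral (`IsBlowup.isIntegral`, Stacks 02ND); it is isomorphic to `X'_κ`
(pasting of fibre products), whose image in `X'` is the special fibre.

References: The Stacks Project, Tags 056P, 0805, 02ND; Q. Liu, *Algebraic Geometry and Arithmetic Curves* (2002),
Prop. 8.1.12 (c), Thm. 8.1.19.
-/

set_option linter.dupNamespace false -- mandated namespace `Summit.<Summit>.<Problem>` of this single-conjunct summit

noncomputable section

open CategoryTheory CategoryTheory.Limits AlgebraicGeometry TopologicalSpace Topology
open Literature.AlgebraicGeometry.Resolution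

namespace Summit.ResolutionOfSingularities.ResolutionOfSingularities.Cruxes.EquisingularLift.StrataSplit

/-- The image of `Spec κ → Spec O` (`κ` the residue field of the local ring `O`) is the closed point. [folklore] -/
theorem range_specMap_residue (O : Type) [CommRing O] [IsLocalRing O] :
    Set.range (Spec.map (CommRingCat.ofHom (IsLocalRing.residue O))) = {IsLocalRing.closedPoint O} := by
  ext p
  exact ZariskiSections.mem_range_specMap_residue_iff O p

/-- The scheme-theoretic special fibre `X ×_{Spec O} Spec κ → X` maps onto the set-theoretic special fibre
`r⁻¹(s₀)`. [folklore] -/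
theorem range_fst_specialFibre (O : Type) [CommRing O] [IsLocalRing O] (X : Scheme.{0})
    (r : X ⟶ Spec (.of O)) :
    Set.range (pullback.fst r (Spec.map (CommRingCat.ofHom (IsLocalRing.residue O)))) =
      r ⁻¹' {IsLocalRing.closedPoint O} := by
  rw [Scheme.Pullback.range_fst, range_specMap_residue]

/-- If the scheme-theoretic special fibre `X ×_{Spec O} Spec κ` is an irreducible space, the set-theoretic special
fibre `r⁻¹(s₀) ⊆ X` is irreducible. [folklore] -/
theorem isIrreducible_preimage_closedPoint (O : Type) [CommRing O] [IsLocalRing O] (X : Scheme.{0})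
    (r : X ⟶ Spec (.of O))
    [IrreducibleSpace ↥(pullback r (Spec.map (CommRingCat.ofHom (IsLocalRing.residue O))))] :
    IsIrreducible (r ⁻¹' {IsLocalRing.closedPoint O}) := by
  rw [← range_fst_specialFibre, ← Set.image_univ]
  exact (IrreducibleSpace.isIrreducible_univ _).image _ (Scheme.Hom.continuous _).continuousOn

/-- If some point of the special fibre `r⁻¹(s₀)` lies off the support of the ideal sheaf `K`, then the pulled-back
ideal sheaf `K · 𝒪_{X_κ}` on the scheme-theoretic special fibre is non-zero. [folklore] -/
theorem comap_fst_specialFibre_ne_bot (O : Type) [CommRing O] [IsLocalRing O] (X : Scheme.{0})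
    (r : X ⟶ Spec (.of O)) (K : X.IdealSheafData)
    (h : ∃ x : X, r x = IsLocalRing.closedPoint O ∧ x ∉ K.support) :
    K.comap (pullback.fst r (Spec.map (CommRingCat.ofHom (IsLocalRing.residue O)))) ≠ ⊥ := by
  obtain ⟨x, hx, hxK⟩ := h
  intro hbot
  obtain ⟨y, hy⟩ : x ∈ Set.range (pullback.fst r (Spec.map (CommRingCat.ofHom (IsLocalRing.residue O)))) := by
    rw [range_fst_specialFibre]; exact hx
  have hmem : y ∈ ((K.comap (pullback.fst r (Spec.map (CommRingCat.ofHom (IsLocalRing.residue O))))).support :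
      Set _) := by
    rw [hbot, Scheme.IdealSheafData.support_bot, Closeds.coe_top]; trivial
  rw [Scheme.IdealSheafData.support_comap, Closeds.coe_preimage, Set.mem_preimage, hy] at hmem
  exact hxK hmem

/-- **H3. Blowing up a centre with flat exceptional divisor keeps the special fibre integral.** For a local ring
`O` with residue field `κ`, `r : X → Spec O`, an ideal sheaf `K` on `X` and a blow-up `τ : X' → X` of `X` along `K`
whose exceptional divisor `V(K · 𝒪_{X'})` is flat over `Spec O`: if the scheme-theoretic special fibre
`X ×_{Spec O} Spec κ` is integral and some point of the special fibre `r⁻¹(s₀)` lies off the support of `K`, then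
`X' ×_{Spec O} Spec κ` is integral and the special fibre `(τ ≫ r)⁻¹(s₀)` of `X'` is irreducible.
[OURS · L1 W4.5b] helper for the crux `EquisingularLift` (chain plan H3); [cite: StacksProject, Tags 056P, 0805, 02ND] -/
theorem isIntegral_specialFibre_of_isBlowup_of_flat_exceptional : ∀ (O : Type) [CommRing O] [IsLocalRing O] (X X' : AlgebraicGeometry.Scheme.{0}) (r : X ⟶ AlgebraicGeometry.Spec (.of O)) (K : X.IdealSheafData) (τ : X' ⟶ X), Literature.AlgebraicGeometry.Resolution.IsBlowup τ K → AlgebraicGeometry.Flat (CategoryTheory.CategoryStruct.comp (K.comap τ).subschemeι (CategoryTheory.CategoryStruct.comp τ r)) → AlgebraicGeometry.IsIntegral (CategoryTheory.Limits.pullback r (AlgebraicGeometry.Spec.map (CommRingCat.ofHom (IsLocalRing.residue O)))) → (∃ x : X, r x = IsLocalRing.closedPoint O ∧ x ∉ K.support) → AlgebraicGeometry.IsIntegral (CategoryTheory.Limits.pullback (CategoryTheory.CategoryStruct.comp τ r) (AlgebraicGeometry.Spec.map (CommRingCat.ofHom (IsLocalRing.residue O)))) ∧ IsIrreducible ((CategoryTheory.CategoryStruct.comp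 τ r) ⁻¹' {IsLocalRing.closedPoint O}) := by
  intro O _ _ X X' r K τ hτ hflat hint hx
  haveI := hflat
  have hB : IsBlowup (pullback.snd τ (pullback.fst r (Spec.map (CommRingCat.ofHom (IsLocalRing.residue O)))))
      (K.comap (pullback.fst r (Spec.map (CommRingCat.ofHom (IsLocalRing.residue O))))) :=
    hτ.pullback_snd_of_flat_exceptional (IsLocalRing.ResidueField O) r
  haveI : IsIntegral (pullback τ (pullback.fst r (Spec.map (CommRingCat.ofHom (IsLocalRing.residue O))))) :=
    hB.isIntegral (comap_fst_specialFibre_ne_bot O X r K hx)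
  haveI : IsIntegral (pullback (τ ≫ r) (Spec.map (CommRingCat.ofHom (IsLocalRing.residue O)))) :=
    IsIntegral.of_isIso
      (pullbackRightPullbackFstIso r (Spec.map (CommRingCat.ofHom (IsLocalRing.residue O))) τ).hom
  exact ⟨inferInstance, isIrreducible_preimage_closedPoint O X' (τ ≫ r)⟩

/-- **H1 + H3. Blowing up a regular `O`-flat centre keeps the special fibre integral.** For a local ring `O`, a
regular locally Noetherian scheme `U` over `Spec O`, an ideal sheaf `K` on `U` whose closed subscheme `V(K)` is
regular and flat over `Spec O`, and a blow-up `τ : U' → U` of `U` along `K`: if the scheme-theoretic special fibre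
`U ×_{Spec O} Spec κ` is integral and some point of the special fibre lies off the centre, then `U' ×_{Spec O} Spec κ`
is integral and the special fibre `(τ ≫ r)⁻¹(s₀)` of `U'` is irreducible (the exceptional divisor is flat over `O` by
`flat_exceptional_of_isBlowup_regularCentre`, Liu Thm. 8.1.19 (b); then H3).
[OURS · L1 W4.5b] helper for the crux `EquisingularLift`; [cite: StacksProject, Tags 056P, 0805, 02ND] -/
theorem isIntegral_specialFibre_of_isBlowup_regularCentre : ∀ (O : Type) [CommRing O] [IsLocalRing O] (U U' : AlgebraicGeometry.Scheme.{0}) [AlgebraicGeometry.IsLocallyNoetherian U] (r : U ⟶ AlgebraicGeometry.Spec (.of O)) (K : U.IdealSheafData), Literature.AlgebraicGeometry.Resolution.Scheme.IsRegular U → Literature.AlgebraicGeometry.Resolution.Scheme.IsRegular K.subscheme → AlgebraicGeometry.Flat (CategoryTheory.CategoryStruct.comp K.subschemeι r) → ∀ (τ : U' ⟶ U), Literature.AlgebraicGeometry.Resolution.IsBlowup τ K → AlgebraicGeometry.IsIntegral (CategoryTheory.Limits.pullback r (AlgebraicGeometry.Spec.map (CommRingCat.ofHom (IsLocalRing.residue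 O)))) → (∃ x : U, r x = IsLocalRing.closedPoint O ∧ x ∉ K.support) → AlgebraicGeometry.IsIntegral (CategoryTheory.Limits.pullback (CategoryTheory.CategoryStruct.comp τ r) (AlgebraicGeometry.Spec.map (CommRingCat.ofHom (IsLocalRing.residue O)))) ∧ IsIrreducible ((CategoryTheory.CategoryStruct.comp τ r) ⁻¹' {IsLocalRing.closedPoint O}) := by
  intro O _ _ U U' _ r K hU hK hflat τ hτ hint hx
  exact isIntegral_specialFibre_of_isBlowup_of_flat_exceptional O U U' r K τ hτ
    (flat_exceptional_of_isBlowup_regularCentre O U U' r K hU hK hflat τ hτ) hint hx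

end Summit.ResolutionOfSingularities.ResolutionOfSingularities.Cruxes.EquisingularLift.StrataSplit

end
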